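import Summits.BirchSwinnertonDyer.BirchSwinnertonDyer.Theorems.GenusKolyvaginAtTwoGenusPrimitiveSupplyAtTwoArchimedeanEgg
import Literature.NumberTheory.GaloisRepresentations.DecompositionGroupOfCompletion
import Literature.NumberTheory.GaloisRepresentations.IntegralGaloisActionProofs
import Literature.NumberTheory.EllipticCurves.SerreOpenImageReductionInertiaProofs
import Literature.NumberTheory.EllipticCurves.TwoPowerTorsion
import HarnessLib

/-!
# Route `GenusKolyvaginAtTwo`, crux `GenusDeepSupplyAtTwoNegDiscNarrow` (stmt-BirchSwinnertonDyer-23491): THE LOCAL KUMMER READING —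
# `loc_v κ(P) = 0` iff a root of `P` is fixed by the DECOMPOSITION GROUP, and the KERNEL HALF of a point reducing to `Õ` at a good prime

Width seat `bsd-line-gk2-p4` g25 (cell `bsd-f1-sign2`), `--supports stmt-BirchSwinnertonDyer-23491` (helper; closes nothing).
THEOREMS ONLY (no definition, no named fact, no `sorry`); **BSD is NOT proved by any of this; no item is closed.**

CONTEXT (Claim B of the LEAD's depth-zero reduction criterion, local half). The global half is in the tree
(`…NegDiscNarrowDepthZeroStrictTwinClasses`, p763963: on the `#Sel₂(E) = 1` cell a twin point `z ∈ Wd(ℚ) ∖ 2Wd(ℚ)` has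
`loc_{ℓ₀} κ(z) ≠ 0`, i.e. `z ∉ 2Wd(ℚ_{ℓ₀})`). To read this on the CURVE `E` at a prime `𝔓 ∣ ℓ₀` of `\bar ℤ` (the LEAD's reduction bit
R₁ is about `red_𝔓(e_* y_K)`), two pieces of plumbing are needed, both supplied here in GEOMETRIC currency (points of `E(ℚ̄)`, no
local field points):

* §1 (any number field `K`, any `V/K`, any `n`) **`localization_kummerMapTorsion_eq_zero_iff_exists_root_fixed`** — `loc_v κ_n(P) = 0`
  iff SOME `n`-th root `R ∈ V(K̄)` of `P` is fixed by the decomposition group `D_{𝔓₀} ≤ Γ_K` of the prime `𝔓₀ = adicCompletionPrime K v`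
  cut out by the completion (`D_{𝔓₀} = res Γ_{K_v}`, tree `decompositionSubgroup_adicCompletionPrime_eq_range`; the Kummer cocycle
  `σ ↦ σQ − Q` restricted to `Γ_{K_v}` is a coboundary `σT − T`, `T ∈ V[n]`, iff `Q − T` is `D`-fixed); the same at ANY prime `𝔓 ∣ v`
  (`…_fixed_of_mem_primesAbove`, transitivity `exists_smul_eq_of_mem_primesAbove_holds`: `D_{γ𝔓₀} = γ D_{𝔓₀} γ⁻¹` and `γ` permutes the
  roots of the rational point `P`); and the dictionary with `K_v`-points: `exists_smul_completion_iff_exists_root_fixed`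
  (`P ∈ nV(K_v) ⟺ a root of P is D_{𝔓₀}-fixed`, via the tree's `localization_kummerMapTorsion_eq_zero_iff`).
* §2 (`W/ℚ` globally minimal, `p ∤ Δ_W`, `red = geomReduction : E(ℚ̄) → Ẽ(𝔽̄_p)` along `placeOver p`, `𝔓` its prime):
  `geomReduction_smul_eq_zero_iff_of_mem_decompositionSubgroup` — `D_𝔓` preserves the kernel of reduction (it stabilises the place);
  **`exists_half_geomReduction_eq_zero`** — a point `P` with `red P = Õ` has a half `R` (`2R = P`) with `red R = Õ` (`p ≠ 2`:
  `red : E[2] ↪ Ẽ[2]` is onto by counting `4 = 4`), UNIQUE (`half_geomReduction_eq_zero_unique`, `E[2] ∩ ker red = 0`), hence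
  **fixed by every `σ ∈ D_𝔓` fixing `P` and negated by every `σ ∈ D_𝔓` negating `P`** (`smul_kernelHalf_eq_of_smul_eq`,
  `smul_kernelHalf_eq_neg_of_smul_eq_neg`).

READING (how the two pieces close Claim B, memo `DEPTH-ZERO-REDUCTION-CRITERION-g21.md` §2): for `y′ = y_K − s ∈ E(K)⁻` and its twin
point `z`, if `red_𝔓(e_* y′) = Õ` then §2 gives a half `R₀` of `e_* y′` fixed by `D_𝔓 ∩ res Γ_K` and negated by the inertia element
`γ ↦ τ`, i.e. — through the signed twist isomorphism `Wd(ℚ̄) ≃ E(ℚ̄)` — a `D_𝔓`-fixed half of `z`, so `loc_{ℓ₀} κ(z) = 0` by §1,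
contradicting p763963. The signed transport itself (tree `exists_addEquiv_geomPoints_quadraticTwist_sign`) is NOT assembled here.

References: [SilvermanAEC2009] VIII §2 (Kummer sequence), VII.2.1, VII.3.1; [NeukirchANT1999] II §9 (9.6), I §9 (9.1);
[SerreLocalFields1979] I §7 Prop. 19–21; [GrossLMS1991] §5.
-/

set_option linter.dupNamespace false -- tree convention: `Summit.BirchSwinnertonDyer.BirchSwinnertonDyer.Theorems` (summit = sub-problem)
set_option autoImplicit false

noncomputable section

open scoped Classical Pointwise

namespace Summit.BirchSwinnertonDyer.BirchSwinnertonDyer.Theorems.GenusSupplyNarrow.DepthZero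

open WeierstrassCurve Field NumberField IsDedekindDomain Function
open Literature.NumberTheory.EllipticCurves Literature.NumberTheory.GaloisRepresentations
open Literature.NumberTheory.GaloisCohomology
open Summit.BirchSwinnertonDyer.BirchSwinnertonDyer.Theorems.GenusKolyArch (localization_kummerMapTorsion_eq_zero_iff)

/-! ## §1 `loc_v κ_n(P) = 0` iff a root of `P` is fixed by the decomposition group -/

section Decomposition

variable {K : Type} [Field K] [NumberField K] (V : WeierstrassCurve K)

/-- **`loc_v κ_n(P) = 0 ⟺ some `n`-th root of `P` in `V(K̄)` is fixed by `res(Γ_{K_v})`** (the image of the restriction map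
`Γ_{K_v} → Γ_K` along the chosen embedding `K̄ → \bar K_v`). Proof: `κ_n(P) = [σ ↦ σQ − Q]` for a root `Q`; its localisation is the
class of the same cocycle on `Γ_{K_v}`, which is a coboundary `σT − T` (`T ∈ V[n]`) iff `res(Γ_{K_v})` fixes the root `Q − T`.
[cite: SilvermanAEC2009, VIII §2 (p. 191)] [cite: SerreGaloisCohomology1997, I §2.4] -/
theorem localization_kummerMapTorsion_eq_zero_iff_exists_root_fixed_range (n : ℤ)
    (hdiv : ∀ P : geomPoints V, ∃ Q : geomPoints V, n • Q = P) (v : HeightOneSpectrum (𝓞 K)) (P : V.toAffine.Point) :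
    galoisCohomology.localization (V.torsionGaloisModule n) (Sum.inr v) 1 (kummerMapTorsion V n hdiv P) = 0 ↔
      ∃ R : geomPoints V, n • R = toGeomPoints V P ∧
        ∀ σ ∈ (absGaloisRestrict K (v.adicCompletion K)).toMonoidHom.range, σ • R = R := by
  set Q : geomPoints V := zsmulRoot V n hdiv P with hQdef
  have hQ : n • Q = toGeomPoints V P := zsmul_zsmulRoot V n hdiv P
  have hQfix := zsmul_zsmulRoot_mem V n hdiv P
  -- the localisation of the Kummer class is the class of the restricted Kummer cocycle
  have h2 := galoisCohomology.res_one_oneCocycleClass (ρ := V.torsionGaloisModule n) (v.adicCompletion K)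
    (kummerCocycleTorsion V n Q hQfix)
  change galoisCohomology.res (V.torsionGaloisModule n) (v.adicCompletion K) 1
    (oneCocycleClass _ (kummerCocycleTorsion V n Q hQfix)) = 0 ↔ _
  rw [h2]
  refine (oneCocycleClass_eq_zero_iff _ _).trans ⟨?_, ?_⟩
  · rintro ⟨w, hw⟩
    refine ⟨Q - (w : geomPoints V), ?_, ?_⟩
    · rw [zsmul_sub, hQ, (mem_geomTorsion_iff V n _).mp w.2, sub_zero]
    · rintro σ ⟨τ, rfl⟩
      have h := congrArg Subtype.val (hw τ)
      change absGaloisRestrict K (v.adicCompletion K) τ • Q - Q =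
        absGaloisRestrict K (v.adicCompletion K) τ • (w : geomPoints V) - w at h
      change absGaloisRestrict K (v.adicCompletion K) τ • (Q - (w : geomPoints V)) = Q - w
      rw [smul_sub, sub_eq_sub_iff_sub_eq_sub.mpr h]
  · rintro ⟨R, hR, hfix⟩
    have hw : Q - R ∈ geomTorsion V n := by
      rw [mem_geomTorsion_iff, zsmul_sub, hQ, hR, sub_self]
    refine ⟨⟨Q - R, hw⟩, fun τ ↦ Subtype.ext ?_⟩
    have hτ := hfix (absGaloisRestrict K (v.adicCompletion K) τ) ⟨τ, rfl⟩
    change absGaloisRestrict K (v.adicCompletion K) τ • Q - Q =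
      absGaloisRestrict K (v.adicCompletion K) τ • (Q - R) - (Q - R)
    rw [smul_sub, hτ]
    abel

/-- **`loc_v κ_n(P) = 0 ⟺ some `n`-th root of `P` in `V(K̄)` is fixed by `D_{𝔓₀}`**, `𝔓₀ = adicCompletionPrime K v` the prime of
`\bar ℤ_K` cut out by the completion at the finite place `v` (`D_{𝔓₀} = res(Γ_{K_v})`, tree
`decompositionSubgroup_adicCompletionPrime_eq_range`). [cite: SilvermanAEC2009, VIII §2 (p. 191)]
[cite: NeukirchANT1999, Ch. II §9 Prop. (9.6)] -/
theorem localization_kummerMapTorsion_eq_zero_iff_exists_root_fixed (n : ℤ)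
    (hdiv : ∀ P : geomPoints V, ∃ Q : geomPoints V, n • Q = P) (v : HeightOneSpectrum (𝓞 K)) (P : V.toAffine.Point) :
    galoisCohomology.localization (V.torsionGaloisModule n) (Sum.inr v) 1 (kummerMapTorsion V n hdiv P) = 0 ↔
      ∃ R : geomPoints V, n • R = toGeomPoints V P ∧
        ∀ σ ∈ (adicCompletionPrime K v).decompositionSubgroup (absoluteGaloisGroup K), σ • R = R := by
  rw [decompositionSubgroup_adicCompletionPrime_eq_range]
  exact localization_kummerMapTorsion_eq_zero_iff_exists_root_fixed_range V n hdiv v P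

/-- **The same at ANY prime `𝔓 ∣ v` of `\bar ℤ_K`** (the decomposition groups of the primes above `v` are conjugate:
`𝔓 = γ • 𝔓₀`, `D_𝔓 = γ D_{𝔓₀} γ⁻¹`, and `γ` carries `D_{𝔓₀}`-fixed roots of the RATIONAL point `P` to `D_𝔓`-fixed roots).
[cite: NeukirchANT1999, Ch. I §9 Prop. (9.1), Ch. II §9 Prop. (9.6)] -/
theorem localization_kummerMapTorsion_eq_zero_iff_exists_root_fixed_of_mem_primesAbove (n : ℤ)
    (hdiv : ∀ P : geomPoints V, ∃ Q : geomPoints V, n • Q = P) (v : HeightOneSpectrum (𝓞 K)) (P : V.toAffine.Point)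
    {𝔓 : Ideal (absIntegers (𝓞 K) K)} (h𝔓 : 𝔓 ∈ v.primesAbove) :
    galoisCohomology.localization (V.torsionGaloisModule n) (Sum.inr v) 1 (kummerMapTorsion V n hdiv P) = 0 ↔
      ∃ R : geomPoints V, n • R = toGeomPoints V P ∧
        ∀ σ ∈ 𝔓.decompositionSubgroup (absoluteGaloisGroup K), σ • R = R := by
  rw [localization_kummerMapTorsion_eq_zero_iff_exists_root_fixed]
  -- `𝔓 = γ • 𝔓₀`, `D_𝔓 = γ D_{𝔓₀} γ⁻¹`
  obtain ⟨γ, hγ⟩ := HeightOneSpectrum.exists_smul_eq_of_mem_primesAbove_holds (K := K) (v := v)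
    (adicCompletionPrime_mem_primesAbove K v) h𝔓
  have hconj : 𝔓.decompositionSubgroup (absoluteGaloisGroup K) =
      MulAut.conj γ • (adicCompletionPrime K v).decompositionSubgroup (absoluteGaloisGroup K) := by
    rw [← hγ]
    exact Ideal.decompositionSubgroup_smul (absoluteGaloisGroup K) (adicCompletionPrime K v) γ
  have hPfix : ∀ σ : absoluteGaloisGroup K, σ • toGeomPoints V P = toGeomPoints V P := fun σ ↦
    toGeomPoints_mem_fixedPoints V P σ
  constructor
  · rintro ⟨R, hR, hfix⟩
    refine ⟨γ • R, ?_, fun σ hσ ↦ ?_⟩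
    · rw [← smul_zsmul_geomPoints, hR, hPfix]
    · rw [hconj, Subgroup.mem_pointwise_smul_iff_inv_smul_mem, MulAut.smul_def, MulAut.conj_inv_apply] at hσ
      have h := hfix _ hσ
      rw [mul_smul, mul_smul, inv_smul_eq_iff] at h
      exact h
  · rintro ⟨R, hR, hfix⟩
    refine ⟨γ⁻¹ • R, ?_, fun x hx ↦ ?_⟩
    · rw [← smul_zsmul_geomPoints, hR, hPfix]
    · have hσ : γ * x * γ⁻¹ ∈ 𝔓.decompositionSubgroup (absoluteGaloisGroup K) := by
        rw [hconj, Subgroup.mem_pointwise_smul_iff_inv_smul_mem, MulAut.smul_def, MulAut.conj_inv_apply]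
        convert hx using 1
        group
      have h := hfix _ hσ
      rw [mul_smul, mul_smul] at h
      -- `γ • x • γ⁻¹ • R = R` ⟹ `x • γ⁻¹ • R = γ⁻¹ • R`
      calc x • γ⁻¹ • R = γ⁻¹ • (γ • x • γ⁻¹ • R) := by rw [inv_smul_smul]
        _ = γ⁻¹ • R := by rw [h]

/-- **`P ∈ nV(K_v) ⟺ a root of `P` in `V(K̄)` is `D_{𝔓₀}`-fixed** (`n ≠ 0`): the local Kummer sequence (tree
`localization_kummerMapTorsion_eq_zero_iff`: `loc_v κ_n(P) = 0 ⟺ P_v ∈ nV(K_v)`) combined with §1.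
[cite: SilvermanAEC2009, VIII §2, X §4 diagram (**)] [cite: NeukirchANT1999, Ch. II §9 Prop. (9.6)] -/
theorem exists_smul_completion_iff_exists_root_fixed [V.IsElliptic] {n : ℤ} (hn : n ≠ 0)
    (hdiv : ∀ P : geomPoints V, ∃ Q : geomPoints V, n • Q = P) (v : HeightOneSpectrum (𝓞 K)) (P : V.toAffine.Point) :
    (∃ R : (V.baseChange (Place.Completion (Sum.inr v : Place K))).toAffine.Point,
        n • R = Affine.Point.baseChange (W' := V) K (Place.Completion (Sum.inr v : Place K)) P) ↔
      ∃ R : geomPoints V, n • R = toGeomPoints V P ∧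
        ∀ σ ∈ (adicCompletionPrime K v).decompositionSubgroup (absoluteGaloisGroup K), σ • R = R := by
  rw [← localization_kummerMapTorsion_eq_zero_iff V hn hdiv (Sum.inr v) P,
    localization_kummerMapTorsion_eq_zero_iff_exists_root_fixed]

end Decomposition

/-! ## §2 The kernel half of a point reducing to `Õ` at a good prime -/

section KernelHalf

variable {W : WeierstrassCurve ℚ} [W.IsGloballyMinimal] [W.IsElliptic] {p : ℕ} [Fact p.Prime]
  (hΔ : ¬ (p : ℤ) ∣ minimalDiscriminantInt W)

omit [W.IsElliptic] in
/-- **The decomposition group preserves the kernel of reduction**: for `σ ∈ D_𝔓`, `𝔓` the prime of `\bar ℤ` of the place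
`placeOver p` (hypothesis `hmem`), and `P ∈ E(ℚ̄)`: `red (σ • P) = Õ ⟺ red P = Õ` — `σ` stabilises the place
(`Ideal.decompositionSubgroup_eq_of_valuationSubring_holds`), hence the kernel of reduction `E₁ = {O} ∪ {x ∉ 𝒪_𝔓}`.
[cite: SerreLocalFields1979, Ch. I §7 Prop. 19–21] [cite: SilvermanAEC2009, Prop. VII.2.1] -/
theorem geomReduction_smul_eq_zero_iff_of_mem_decompositionSubgroup {𝔓 : Ideal (absIntegers (𝓞 ℚ) ℚ)}
    (hmem : ∀ x : absIntegers (𝓞 ℚ) ℚ, x ∈ 𝔓 ↔ (x : AlgebraicClosure ℚ) ∈ (placeOver p).nonunits)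
    {σ : absoluteGaloisGroup ℚ} (hσ : σ ∈ 𝔓.decompositionSubgroup (absoluteGaloisGroup ℚ)) (P : W.geomPoints) :
    geomReduction hΔ (σ • P) = 0 ↔ geomReduction hΔ P = 0 := by
  haveI : Algebra.IsAlgebraic ℚ (AlgebraicClosure ℚ) := AlgebraicClosure.isAlgebraic ℚ
  have hD := Ideal.decompositionSubgroup_eq_of_valuationSubring_holds (R := 𝓞 ℚ) (K := ℚ)
    (L := AlgebraicClosure ℚ) (placeOver p) (fun x ↦ coe_absIntegers_mem_placeOver p x) 𝔓 hmem
  have hstab : (absoluteGaloisGroup.toAlgEquiv ℚ σ) • placeOver p = placeOver p := by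
    have hσ' : absoluteGaloisGroup.toAlgEquiv ℚ σ ∈ (placeOver p).decompositionSubgroup ℚ := by
      rw [← hD]; exact hσ
    exact hσ'
  have hmemσ : ∀ z : AlgebraicClosure ℚ, σ • z ∈ placeOver p ↔ z ∈ placeOver p := by
    intro z
    conv_lhs => rw [← hstab]
    rw [absoluteGaloisGroup.smul_def]
    exact ValuationSubring.smul_mem_pointwise_smul_iff
  rcases P with _ | ⟨x, y, hxy⟩
  · change geomReduction hΔ (σ • (0 : W.geomPoints)) = 0 ↔ geomReduction hΔ (0 : W.geomPoints) = 0
    rw [smul_zero]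
  · set φ : AlgebraicClosure ℚ →ₐ[ℚ] AlgebraicClosure ℚ := (absoluteGaloisGroup.toAlgEquiv ℚ σ).toAlgHom with hφ
    have hφinj : Function.Injective φ := (absoluteGaloisGroup.toAlgEquiv ℚ σ).injective
    have hσxy : (W.baseChange (AlgebraicClosure ℚ)).toAffine.Nonsingular (σ • x) (σ • y) :=
      (Affine.baseChange_nonsingular (W := W.toAffine) hφinj x y).mpr hxy
    change geomReduction hΔ (Affine.Point.some (σ • x) (σ • y) hσxy) = 0 ↔
      geomReduction hΔ (Affine.Point.some x y hxy) = 0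
    by_cases hx : x ∈ placeOver p
    · -- integral point: both reduce to affine (non-zero) points
      have hv := integers_placeOver p
      have heq : ((placeModel p W).baseChange (AlgebraicClosure ℚ)).toAffine.Equation x y := by
        rw [placeModel_baseChange]; exact hxy.left
      have hy1 : (placeOver p).valuation y ≤ 1 :=
        v_Y_le_one_of_v_X_le_one (W := placeModel p W) hv heq ((ValuationSubring.valuation_le_one_iff _ _).mpr hx)
      have hy : y ∈ placeOver p := (ValuationSubring.valuation_le_one_iff _ _).mp hy1
      obtain ⟨h₁, hred₁⟩ := geomReduction_some_coe hΔ ⟨x, hx⟩ ⟨y, hy⟩ hxy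
      obtain ⟨h₂, hred₂⟩ := geomReduction_some_coe hΔ ⟨σ • x, (hmemσ x).mpr hx⟩ ⟨σ • y, (hmemσ y).mpr hy⟩ hσxy
      change geomReduction hΔ (Affine.Point.some ((⟨σ • x, (hmemσ x).mpr hx⟩ : placeOver p) : AlgebraicClosure ℚ)
          ((⟨σ • y, (hmemσ y).mpr hy⟩ : placeOver p) : AlgebraicClosure ℚ) hσxy) = 0 ↔
        geomReduction hΔ (Affine.Point.some ((⟨x, hx⟩ : placeOver p) : AlgebraicClosure ℚ)
          ((⟨y, hy⟩ : placeOver p) : AlgebraicClosure ℚ) hxy) = 0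
      rw [hred₁, hred₂]
      exact ⟨fun h ↦ absurd h (Affine.Point.some_ne_zero _), fun h ↦ absurd h (Affine.Point.some_ne_zero _)⟩
    · -- `x ∉ 𝒪`: both reduce to `Õ`
      have hx' : 1 < (placeOver p).valuation x := by
        rw [← not_le, ValuationSubring.valuation_le_one_iff]; exact hx
      have hσx' : 1 < (placeOver p).valuation (σ • x) := by
        rw [← not_le, ValuationSubring.valuation_le_one_iff, hmemσ]; exact hx
      rw [geomReduction_some_of_one_lt hΔ hσxy hσx', geomReduction_some_of_one_lt hΔ hxy hx']

/-- **A point reducing to `Õ` has a HALF reducing to `Õ`** (`p ≠ 2`). Take any half `R'` (`E(ℚ̄)` is `2`-divisible); `red R'` is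
`2`-torsion in `Ẽ(𝔽̄_p)`; `red : E[2] → Ẽ[2]` is injective (`E[2] ∩ E₁ = 0`, Prop. VII.3.1(b)) between sets of `4 = 4` elements, hence
onto: `red T = red R'` for some `T ∈ E[2]`, and `R = R' − T` works. [cite: SilvermanAEC2009, Prop. VII.3.1(b), Cor. III.6.4(b)] -/
theorem exists_half_geomReduction_eq_zero (hp2 : p ≠ 2) {P : W.geomPoints} (hP : geomReduction hΔ P = 0) :
    ∃ R : W.geomPoints, (2 : ℤ) • R = P ∧ geomReduction hΔ R = 0 := by
  haveI hE : (reductionModPrime W p).IsElliptic := isElliptic_reductionModPrime W hΔ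
  obtain ⟨R', hR'⟩ := W.zsmul_geomPoints_surjective_of_charZero (n := 2) (by norm_num) P
  have hR' : (2 : ℤ) • R' = P := hR'
  -- `red R'` is `2`-torsion
  have hu : (2 : ℤ) • geomReduction hΔ R' = 0 := by rw [← map_zsmul, hR', hP]
  -- `red : E[2] → Ẽ[2]` is a bijection (injective between finite sets of the same size)
  have hp2' : ¬ p ∣ 2 := fun h ↦ hp2 ((Nat.prime_dvd_prime_iff_eq (Fact.out) Nat.prime_two).mp h)
  let r : geomTorsion W (2 : ℤ) → geomTorsion (reductionModPrime W p) (2 : ℤ) := fun T ↦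
    ⟨geomReduction hΔ T, by
      rw [mem_geomTorsion_iff, ← map_zsmul, (mem_geomTorsion_iff W (2 : ℤ) _).mp T.2, map_zero]⟩
  have hr_inj : Function.Injective r := by
    intro T₁ T₂ h
    have h' : geomReduction hΔ (T₁ : W.geomPoints) = geomReduction hΔ T₂ := congrArg Subtype.val h
    have hsub : geomReduction hΔ ((T₁ : W.geomPoints) - T₂) = 0 := by rw [map_sub, h', sub_self]
    have h2 : (2 : ℕ) • ((T₁ : W.geomPoints) - T₂) = 0 := by
      rw [← natCast_zsmul, Nat.cast_ofNat, zsmul_sub, (mem_geomTorsion_iff W (2 : ℤ) _).mp T₁.2,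
        (mem_geomTorsion_iff W (2 : ℤ) _).mp T₂.2, sub_self]
    exact Subtype.ext (sub_eq_zero.mp (eq_zero_of_smul_eq_zero_of_geomReduction_eq_zero hΔ hp2' h2 hsub))
  have hcardW : Nat.card (geomTorsion W (2 : ℤ)) = 4 := by
    simpa using card_geomTorsion_two_pow W two_ne_zero 1
  have h2p : (2 : ZMod p) ≠ 0 := by
    intro h
    apply hp2'
    exact (ZMod.natCast_eq_zero_iff 2 p).mp (by exact_mod_cast h)
  have hcardE : Nat.card (geomTorsion (reductionModPrime W p) (2 : ℤ)) = 4 := by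
    simpa using card_geomTorsion_two_pow (reductionModPrime W p) h2p 1
  haveI : Finite (geomTorsion W (2 : ℤ)) := Nat.finite_of_card_ne_zero (by rw [hcardW]; norm_num)
  haveI : Finite (geomTorsion (reductionModPrime W p) (2 : ℤ)) := Nat.finite_of_card_ne_zero (by rw [hcardE]; norm_num)
  have hr_bij : Function.Bijective r := hr_inj.bijective_of_nat_card_le (by rw [hcardW, hcardE])
  obtain ⟨T, hT⟩ := hr_bij.2 ⟨geomReduction hΔ R', (mem_geomTorsion_iff _ (2 : ℤ) _).mpr hu⟩
  refine ⟨R' - T, ?_, ?_⟩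
  · rw [zsmul_sub, hR', (mem_geomTorsion_iff W (2 : ℤ) _).mp T.2, sub_zero]
  · rw [map_sub, sub_eq_zero]
    exact (congrArg Subtype.val hT).symm

omit [W.IsElliptic] in
/-- **Uniqueness of the kernel half**: two halves of the same point both reducing to `Õ` are equal (`p ≠ 2`; their difference lies in
`E[2] ∩ E₁ = 0`). [cite: SilvermanAEC2009, Prop. VII.3.1(b)] -/
theorem half_geomReduction_eq_zero_unique (hp2 : p ≠ 2) {P R₁ R₂ : W.geomPoints}
    (h₁ : (2 : ℤ) • R₁ = P) (hred₁ : geomReduction hΔ R₁ = 0) (h₂ : (2 : ℤ) • R₂ = P) (hred₂ : geomReduction hΔ R₂ = 0) :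
    R₁ = R₂ := by
  have hp2' : ¬ p ∣ 2 := fun h ↦ hp2 ((Nat.prime_dvd_prime_iff_eq (Fact.out) Nat.prime_two).mp h)
  have hsub : geomReduction hΔ (R₁ - R₂) = 0 := by rw [map_sub, hred₁, hred₂, sub_self]
  have h2 : (2 : ℕ) • (R₁ - R₂) = 0 := by
    rw [← natCast_zsmul, Nat.cast_ofNat, zsmul_sub, h₁, h₂, sub_self]
  exact sub_eq_zero.mp (eq_zero_of_smul_eq_zero_of_geomReduction_eq_zero hΔ hp2' h2 hsub)

omit [W.IsElliptic] in
/-- **The kernel half is FIXED by every `σ ∈ D_𝔓` fixing `P`**: `σR` is again a half of `σP = P` reducing to `Õ` (§2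
`geomReduction_smul_eq_zero_iff_of_mem_decompositionSubgroup`), so `σR = R` by uniqueness. [cite: SilvermanAEC2009, Prop. VII.3.1(b)]
[cite: SerreLocalFields1979, Ch. I §7 Prop. 19–21] -/
theorem smul_kernelHalf_eq_of_smul_eq (hp2 : p ≠ 2) {𝔓 : Ideal (absIntegers (𝓞 ℚ) ℚ)}
    (hmem : ∀ x : absIntegers (𝓞 ℚ) ℚ, x ∈ 𝔓 ↔ (x : AlgebraicClosure ℚ) ∈ (placeOver p).nonunits)
    {σ : absoluteGaloisGroup ℚ} (hσ : σ ∈ 𝔓.decompositionSubgroup (absoluteGaloisGroup ℚ))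
    {P R : W.geomPoints} (hR : (2 : ℤ) • R = P) (hred : geomReduction hΔ R = 0) (hσP : σ • P = P) :
    σ • R = R := by
  refine half_geomReduction_eq_zero_unique hΔ hp2 (P := P) ?_ ?_ hR hred
  · rw [← smul_zsmul_geomPoints, hR, hσP]
  · exact (geomReduction_smul_eq_zero_iff_of_mem_decompositionSubgroup hΔ hmem hσ R).mpr hred

omit [W.IsElliptic] in
/-- **The kernel half is NEGATED by every `σ ∈ D_𝔓` negating `P`**: `σR` and `−R` are halves of `−P` reducing to `Õ`.
[cite: SilvermanAEC2009, Prop. VII.3.1(b)] [cite: SerreLocalFields1979, Ch. I §7 Prop. 19–21] -/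
theorem smul_kernelHalf_eq_neg_of_smul_eq_neg (hp2 : p ≠ 2) {𝔓 : Ideal (absIntegers (𝓞 ℚ) ℚ)}
    (hmem : ∀ x : absIntegers (𝓞 ℚ) ℚ, x ∈ 𝔓 ↔ (x : AlgebraicClosure ℚ) ∈ (placeOver p).nonunits)
    {σ : absoluteGaloisGroup ℚ} (hσ : σ ∈ 𝔓.decompositionSubgroup (absoluteGaloisGroup ℚ))
    {P R : W.geomPoints} (hR : (2 : ℤ) • R = P) (hred : geomReduction hΔ R = 0) (hσP : σ • P = -P) :
    σ • R = -R := by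
  refine half_geomReduction_eq_zero_unique hΔ hp2 (P := -P) ?_ ?_ ?_ ?_
  · rw [← smul_zsmul_geomPoints, hR, hσP]
  · exact (geomReduction_smul_eq_zero_iff_of_mem_decompositionSubgroup hΔ hmem hσ R).mpr hred
  · rw [zsmul_neg, hR]
  · rw [map_neg, hred, neg_zero]

end KernelHalf

end Summit.BirchSwinnertonDyer.BirchSwinnertonDyer.Theorems.GenusSupplyNarrow.DepthZero

end
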